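import Literature.MathematicalPhysics.QuantumFieldTheory.Balaban1983to89.B6Cov2110MatrixV1
import Literature.MathematicalPhysics.QuantumFieldTheory.Balaban1983to89.B6Cov2110WeightV1
import Literature.MathematicalPhysics.QuantumFieldTheory.Balaban1983to89.B6QppKernelV1
import Literature.MathematicalPhysics.QuantumFieldTheory.Balaban1983to89.B6Eq2146TwoScale

/-!
# `Balaban1983to89.B6Kernel2147DecayV1` — T. Bałaban, *Propagators and renormalization transformations for lattice gauge
# theories. II*, Commun. Math. Phys. **96** (1984) 223–250 [Balaban1984PropagatorsII], p. 248 (text after (2.147)): **«Of course we have also a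
# similar bound from above and an exponential decay of a kernel of the operator in (2.147)» — THE EXPONENTIAL DECAY OF THE KERNEL OF `QGQ*` ON
# `L²(𝔅)`, FOR THE CONCRETE TWO-SCALE DATA `tsV1`**: through (2.146) `⟨x, QGQ*y⟩ = ⟨Q″*x, C̃^{(j)}_ΛQ″*y⟩`, the block locality and the unit masses of
# `Q″`, the decay of the kernel of `C̃^{(j)}_Λ` (`…B6CovTildeDecayV1`) transfers to `QGQ*` with the same rate

statement-level skeleton of published theorems with citation tags; proofs where landed; nothing here is a claim about the Yang–Mills mass gap

PDF held: `paper:balaban1984-cmp96-propagators-rt-ii` (journal page = PDF page + 222; p. 248 [PDF 26] read AS IMAGE on the ×2 render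
`run/shared/lean/pub/pub-balaban/b2b-balaban-ref1/pages/1984-cmp96-propagators-rt-II/…-p026-x2.png`, 2026-08-22).

PRINT (verbatim, p. 248).  *"⟨B, QGQ*B⟩ = ⟨Q″*B, C̃^{(j)}_ΛQ″*B⟩ = ⟨B₁, C̃^{(j)}_ΛB₁⟩, (2.146) … ⟨B, (QG_□Q*)↾_□B⟩ ≥ γ₀‖B‖² (2.147) with a positive
constant γ₀ depending on d and L only. Of course we have also a similar bound from above and an exponential decay of a kernel of the operator in
(2.147)."*

CITATION HEADER (lean-in-tree rule) — WHAT IS REPRODUCED.  Phase-2 file of the `lit-balaban` typed skeleton (HOME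
`run/shared/lean/pub/lit-balaban/`), seat **p22 gen 12** (B6 fold owner r03, referee ref-4; lane = the Sect. C chain (2.95)–(2.147) on the
concrete two-scale data `tsV1`).  SKELETON row **B6.Eq2.144** ((2.144)–(2.147); the lower bound is gen 10's `…B6Ineq2147TwoScaleV1B1.ineq2147_V1`, the
«similar bound from above» gen 11's `…B6Ineq2122TwoScaleV1.ineq2147_V1_upper`; THIS FILE: the «exponential decay of a kernel» clause, INSTANCED).
IMPORTS BY NAME: gen 8's `…B6Eq2146TwoScale.eq2146_printed_V1` ((2.146) for `tsV1`), gen 8's `…B6SectCPositivity.G_symm/Ct_symm_pos`,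
`…B6QppKernelV1.qpp_single_nonneg/qpp_single_inl_ne_zero/qpp_single_inr_ne_zero/sum_qpp_single_col`, gen 11's `…B6Cov2110MatrixV1.
dotProduct_siteMatrix_mulVec`, `…B6Cov2110WeightV1.torusSupNorm_anchor_le/torusSupNorm_sub_le/torusSupNorm_neg/torusSupNorm_zero`; the decay of the
kernel of `C̃^{(j)}_Λ` itself (`…B6CovTildeDecayV1.covt_kernel_decay_uniform`) is NOT imported here: the uniform corollary `kernel2147_decay_uniform` (∀ d L a₀ a₁
∃ δ > 0 ∀ volume, c, j, Λ′, weights, i, i′) is stated THERE, from this file's transfer theorem.  THIS FILE (parameter set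
written `⟨d + 1, L, m, K, _, _⟩`; `q_i(b) = (Q″e_b)_i`; the POSITION of an index `i ∈ 𝔅 = Λ^c ⊔ Λ′`: `p(o) = x_{o₋}` for a `Λ^c`-bond `o`, `p(c) = x̂(c₋)` the
anchor of the block `B(c₋)` for a `Λ′`-bond `c` — written inline as `Sum.elim`):
* §1 **`inner_QGQ_eq_Ct₂`** (POLARIZED (2.146): `⟨x, QGQ*y⟩ = ⟨Q″*x, C̃^{(j)}_ΛQ″*y⟩`), **`inner_single_QGQ_single`** (the kernel:
  `⟨e_i, QGQ*e_{i′}⟩ = Σ_{b,b′} q_i(b)·⟨e_b, C̃^{(j)}_Λe_{b′}⟩·q_{i′}(b′)`);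
* §2 **`dist_pos_le_of_qpp_ne_zero`** (`q_i(b) ≠ 0 ⇒ |x_b − p(i)|_T ≤ 2L − 1`), **`kernel2147_decay_of_Ct_decay`** (a bound `|⟨e_b, C̃e_{b′}⟩| ≤ Ae^{−δ|x_b−x_{b′}|_T}`
  gives `|⟨e_i, QGQ*e_{i′}⟩| ≤ A·e^{2δ(2L−1)}·e^{−δ|p(i) − p(i′)|_T}` — unit column masses of `Q″`): *«an exponential decay of a kernel of the operator in
  (2.147)»* REDUCED to the decay of the kernel of `C̃^{(j)}_Λ` (p.246), with the same rate.
THEOREMS ONLY (no definition, no `def … : Prop` fact); standard axioms.  HONEST SCOPE: ENTRY bound for gen 7's typed `QGQ* = Q″Q_jΔ_a⁻¹Q_j*Q″*` of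
`tsV1` on `L²(𝔅)` (the whole `𝔅 = Λ^c ⊔ Λ′`; print restricts to `□`), positions/distances ours; rate and prefactor those of the `C̃^{(j)}_Λ` bound fed in;
NOT summit progress.
-/

noncomputable section

open scoped InnerProductSpace
open Finset Matrix

namespace Literature.MathematicalPhysics.QuantumFieldTheory.Balaban1983to89.B6Kernel2147DecayV1

open LatticeFieldCalculus B6SectAOperatorsV1 B6SectCTwoScaleV1 B6SectCTwoScaleV1Lattice
open B6SectCOperators (TwoScaleData)
open B6SectCPositivity (G_symm Ct_symm_pos)
open B5SectBStatements (eta)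
open B4TorusKernel.MultiPeriod (torusSupNorm torusSupNorm_nonneg)
open B5Eq117TorusCarriers (Mk)
open B6LowerBound2153Torus (rep)
open B6Cov2156Torus (one_le_M)
open B6Eq2146TwoScale (eq2146_printed_V1)
open B6Cov2110MatrixV1 (dotProduct_siteMatrix_mulVec)
open B6Cov2110WeightV1 (torusSupNorm_anchor_le torusSupNorm_sub_le torusSupNorm_neg torusSupNorm_zero)
open B6QppKernelV1 (qpp_single_nonneg qpp_single_inl_ne_zero qpp_single_inr_ne_zero sum_qpp_single_col)
open B4TorusKernel.MultiPeriod (circAbs circAbs_le_abs circAbs_add_mul)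
open B4Sect5Torus (circAbs_zero)

/-! ## §1  The kernel of `QGQ*` through (2.146) -/

section V1

variable {P : Params} {c : ℝ} (hc : c ≠ 0) {j : ℕ} (hj : j + 1 ≤ P.m + P.K) (Λ' : Finset (Site P (j + 1)))
  {w : CIdx j Λ' → ℝ} (hw : ∀ i, 0 < w i) [DecidableEq (PBond P j)] [DecidableEq (CIdx j Λ')]

omit [DecidableEq (PBond P j)] [DecidableEq (CIdx j Λ')] in
include hj hw in
/-- **(2.146) POLARIZED**: `⟨x, QGQ*y⟩ = ⟨Q″*x, C̃^{(j)}_ΛQ″*y⟩` for all `x, y ∈ L²(𝔅)` — both sides are symmetric bilinear forms (`G_symm`, `Ct_symm_pos`)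
with equal quadratic forms (gen 8's `eq2146_printed_V1`). [cite: Balaban1984PropagatorsII, (2.146) p.248] -/
theorem inner_QGQ_eq_Ct₂ (x y : CSpace j Λ') :
    ⟪x, (tsV1 hc Λ' w).Q ((tsV1 hc Λ' w).G (LinearMap.adjoint (tsV1 hc Λ' w).Q y))⟫_ℝ =
      ⟪LinearMap.adjoint (tsV1 hc Λ' w).Qpp x, (tsV1 hc Λ' w).Ct (LinearMap.adjoint (tsV1 hc Λ' w).Qpp y)⟫_ℝ := by
  have hL := isLattice Λ' hc hj hw
  have hP := positive Λ' hc hj w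
  have hq : ∀ z : CSpace j Λ', ⟪z, (tsV1 hc Λ' w).Q ((tsV1 hc Λ' w).G (LinearMap.adjoint (tsV1 hc Λ' w).Q z))⟫_ℝ =
      ⟪LinearMap.adjoint (tsV1 hc Λ' w).Qpp z, (tsV1 hc Λ' w).Ct (LinearMap.adjoint (tsV1 hc Λ' w).Qpp z)⟫_ℝ :=
    fun z => eq2146_printed_V1 hc hj Λ' hw z
  -- both sides as forms `⟨T*x, S T*y⟩` with `S` symmetric
  have hl : ∀ a b : CSpace j Λ', ⟪a, (tsV1 hc Λ' w).Q ((tsV1 hc Λ' w).G (LinearMap.adjoint (tsV1 hc Λ' w).Q b))⟫_ℝ =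
      ⟪LinearMap.adjoint (tsV1 hc Λ' w).Q a, (tsV1 hc Λ' w).G (LinearMap.adjoint (tsV1 hc Λ' w).Q b)⟫_ℝ := fun a b => by
    rw [← LinearMap.adjoint_inner_left]
  have hls : ⟪y, (tsV1 hc Λ' w).Q ((tsV1 hc Λ' w).G (LinearMap.adjoint (tsV1 hc Λ' w).Q x))⟫_ℝ =
      ⟪x, (tsV1 hc Λ' w).Q ((tsV1 hc Λ' w).G (LinearMap.adjoint (tsV1 hc Λ' w).Q y))⟫_ℝ := by
    rw [hl, hl, real_inner_comm, G_symm hL hP]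
  have hrs : ⟪LinearMap.adjoint (tsV1 hc Λ' w).Qpp y, (tsV1 hc Λ' w).Ct (LinearMap.adjoint (tsV1 hc Λ' w).Qpp x)⟫_ℝ =
      ⟪LinearMap.adjoint (tsV1 hc Λ' w).Qpp x, (tsV1 hc Λ' w).Ct (LinearMap.adjoint (tsV1 hc Λ' w).Qpp y)⟫_ℝ := by
    rw [real_inner_comm, (Ct_symm_pos hL hP).1]
  have h := hq (x + y)
  rw [map_add, map_add, map_add, inner_add_left, inner_add_right, inner_add_right, map_add, map_add, inner_add_left, inner_add_right,
    inner_add_right, hq x, hq y, hls, hrs] at h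
  linarith

omit [DecidableEq (CIdx j Λ')] in
/-- the bond components of `Q″*e_i` are the entries `q_i(b) = (Q″e_b)_i`. [cite: Balaban1984PropagatorsII, (2.146) p.248] -/
theorem adjoint_Qpp_apply (x : CSpace j Λ') (b : PBond P j) :
    (LinearMap.adjoint (Qpp P j Λ') x) b = ⟪Qpp P j Λ' (EuclideanSpace.single b (1 : ℝ)), x⟫_ℝ := by
  rw [← LinearMap.adjoint_inner_right, EuclideanSpace.inner_single_left, conj_trivial, one_mul]

include hj hw in
/-- **THE KERNEL OF `QGQ*`**: `⟨e_i, QGQ*e_{i′}⟩ = Σ_b Σ_{b′} q_i(b)·⟨e_b, C̃^{(j)}_Λe_{b′}⟩·q_{i′}(b′)`. [cite: Balaban1984PropagatorsII, (2.146) p.248] -/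
theorem inner_single_QGQ_single (i i' : CIdx j Λ') :
    ⟪EuclideanSpace.single i (1 : ℝ), (tsV1 hc Λ' w).Q ((tsV1 hc Λ' w).G (LinearMap.adjoint (tsV1 hc Λ' w).Q (EuclideanSpace.single i' (1 : ℝ))))⟫_ℝ =
      ∑ b : PBond P j, ∑ b' : PBond P j, Qpp P j Λ' (EuclideanSpace.single b (1 : ℝ)) i *
        ⟪EuclideanSpace.single b (1 : ℝ), (tsV1 hc Λ' w).Ct (EuclideanSpace.single b' (1 : ℝ))⟫_ℝ * Qpp P j Λ' (EuclideanSpace.single b' (1 : ℝ)) i' := by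
  rw [inner_QGQ_eq_Ct₂ hc hj Λ' hw]
  have hu : ∀ k : CIdx j Λ', LinearMap.adjoint (tsV1 hc Λ' w).Qpp (EuclideanSpace.single k (1 : ℝ)) =
      WithLp.toLp 2 (fun b : PBond P j => Qpp P j Λ' (EuclideanSpace.single b (1 : ℝ)) k) := by
    intro k
    ext b
    rw [PiLp.toLp_apply]
    show (LinearMap.adjoint (Qpp P j Λ') (EuclideanSpace.single k (1 : ℝ))) b = _
    rw [adjoint_Qpp_apply, EuclideanSpace.inner_single_right]
    simp
  rw [hu, hu, ← dotProduct_siteMatrix_mulVec]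
  simp only [dotProduct, Matrix.mulVec, Matrix.of_apply, Finset.mul_sum]
  refine Finset.sum_congr rfl fun b _ => Finset.sum_congr rfl fun b' _ => ?_
  rw [EuclideanSpace.inner_single_left, conj_trivial, one_mul]
  ring

end V1

/-! ## §2  Transfer of the decay of `C̃^{(j)}_Λ` to `QGQ*` -/

section Decay

variable {d L m K : ℕ} {hd : 1 ≤ d + 1} {hL : Odd L ∧ 1 < L} {c : ℝ} (hc : c ≠ 0) {j : ℕ}
  (Λ' : Finset (Site (⟨d + 1, L, m, K, hd, hL⟩ : Params) (j + 1))) {w : CIdx j Λ' → ℝ} (hw : ∀ i, 0 < w i)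
  [DecidableEq (PBond (⟨d + 1, L, m, K, hd, hL⟩ : Params) j)] [DecidableEq (CIdx j Λ')]

omit [DecidableEq (PBond (⟨d + 1, L, m, K, hd, hL⟩ : Params) j)] in
/-- the anchors of adjacent blocks are within `L`: `|x̂(y + e_μ) − x̂(y)|_T ≤ L` (labels differ by `L` in the coordinate `μ`, or by `−(N − 1)L ≡ L`
modulo the period `N·L` at the wrap-around). [cite: Balaban1984PropagatorsI, (1.6) p.18] -/
private theorem anchor_shift_le (hj : j + 1 ≤ m + K) (y : Site (⟨d + 1, L, m, K, hd, hL⟩ : Params) (j + 1)) (μ : Fin (d + 1)) :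
    torusSupNorm (Mk ⟨d + 1, L, m, K, hd, hL⟩ j)
        (rep (Mk ⟨d + 1, L, m, K, hd, hL⟩ j) (Site.blockSite (y.shift μ) (fun _ => ⟨0, Params.L_pos _⟩)) -
          rep (Mk ⟨d + 1, L, m, K, hd, hL⟩ j) (Site.blockSite y (fun _ => ⟨0, Params.L_pos _⟩))) ≤ L := by
  have hjP : j + 1 ≤ (⟨d + 1, L, m, K, hd, hL⟩ : Params).m + (⟨d + 1, L, m, K, hd, hL⟩ : Params).K := hj
  unfold torusSupNorm
  refine Finset.sup'_le _ _ fun i _ => ?_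
  have hval : ∀ z : Site (⟨d + 1, L, m, K, hd, hL⟩ : Params) (j + 1),
      rep (Mk ⟨d + 1, L, m, K, hd, hL⟩ j) (Site.blockSite z (fun _ => ⟨0, Params.L_pos _⟩)) i = ((z i).val : ℤ) * L := by
    intro z
    simp only [rep]
    rw [Site.val_blockSite (P := ⟨d + 1, L, m, K, hd, hL⟩) hjP]
    simp only [add_zero, Nat.cast_mul]
  rw [Pi.sub_apply, hval, hval]
  by_cases hi : i = μ
  · subst hi
    have hshift : (y.shift i) i = y i + 1 := by simp [Site.shift]
    rw [hshift, ZMod.val_add, ZMod.val_one]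
    set v := (y i).val with hv
    have hvlt : v < (⟨d + 1, L, m, K, hd, hL⟩ : Params).sitesPerDir (j + 1) := ZMod.val_lt _
    by_cases hwrap : v + 1 < (⟨d + 1, L, m, K, hd, hL⟩ : Params).sitesPerDir (j + 1)
    · rw [Nat.mod_eq_of_lt hwrap]
      have h1 : (((v + 1 : ℕ) : ℤ) * L - (v : ℤ) * L) = (L : ℤ) := by push_cast; ring
      rw [h1]
      have h2 := circAbs_le_abs (one_le_M (Mk ⟨d + 1, L, m, K, hd, hL⟩ j) i) (L : ℤ)
      rw [abs_of_nonneg (by positivity)] at h2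
      exact_mod_cast h2
    · have heq : v + 1 = (⟨d + 1, L, m, K, hd, hL⟩ : Params).sitesPerDir (j + 1) := by omega
      rw [heq, Nat.mod_self]
      have hM : Mk ⟨d + 1, L, m, K, hd, hL⟩ j i = (⟨d + 1, L, m, K, hd, hL⟩ : Params).sitesPerDir (j + 1) * L :=
        (⟨d + 1, L, m, K, hd, hL⟩ : Params).sitesPerDir_eq_mul_succ hjP
      have h1 : (((0 : ℕ) : ℤ) * L - (v : ℤ) * L) =
          (L : ℤ) + (((⟨d + 1, L, m, K, hd, hL⟩ : Params).sitesPerDir (j + 1) * L : ℕ) : ℤ) * (-1) := by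
        have : (v : ℤ) = ((⟨d + 1, L, m, K, hd, hL⟩ : Params).sitesPerDir (j + 1) : ℤ) - 1 := by rw [← heq]; push_cast; ring
        rw [this]
        push_cast
        ring
      rw [h1, ← hM, circAbs_add_mul]
      have h2 := circAbs_le_abs (one_le_M (Mk ⟨d + 1, L, m, K, hd, hL⟩ j) i) (L : ℤ)
      rw [abs_of_nonneg (by positivity)] at h2
      exact_mod_cast h2
  · have hshift : (y.shift μ) i = y i := by simp [Site.shift, Function.update_of_ne hi]
    rw [hshift, sub_self, circAbs_zero]
    exact_mod_cast (Nat.zero_le L)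

omit [DecidableEq (CIdx j Λ')] in
/-- **THE ENTRIES OF `Q″` ARE LOCAL AROUND THE POSITION OF THE INDEX**: `q_i(b) ≠ 0 ⇒ |x_b − p(i)|_T ≤ 2L − 1`, `p(o) = x_{o₋}` for a `Λ^c`-bond `o`,
`p(c) = x̂(c₋)` (anchor of `B(c₋)`) for a `Λ′`-bond `c`. [cite: Balaban1984PropagatorsII, (2.146) p.248] -/
theorem dist_pos_le_of_qpp_ne_zero (hj : j + 1 ≤ m + K) (i : CIdx j Λ') (b : PBond (⟨d + 1, L, m, K, hd, hL⟩ : Params) j)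
    (hb : Qpp ⟨d + 1, L, m, K, hd, hL⟩ j Λ' (EuclideanSpace.single b (1 : ℝ)) i ≠ 0) :
    torusSupNorm (Mk ⟨d + 1, L, m, K, hd, hL⟩ j) (rep (Mk ⟨d + 1, L, m, K, hd, hL⟩ j) b.src -
        Sum.elim (fun o : OutBond j Λ' => rep (Mk ⟨d + 1, L, m, K, hd, hL⟩ j) o.1.src)
          (fun e : InBond j Λ' => rep (Mk ⟨d + 1, L, m, K, hd, hL⟩ j) (Site.blockSite e.1.src (fun _ => ⟨0, Params.L_pos _⟩))) i) ≤
      2 * (L : ℝ) - 1 := by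
  set M := Mk (⟨d + 1, L, m, K, hd, hL⟩ : Params) j with hM
  have hL1 : (1 : ℝ) ≤ L := by exact_mod_cast hL.2.le
  rcases i with o | e
  · rw [Sum.elim_inl, qpp_single_inl_ne_zero Λ' hb, sub_self, torusSupNorm_zero]
    linarith
  · rw [Sum.elim_inr]
    have hblk := qpp_single_inr_ne_zero Λ' hj hb
    have h1 : torusSupNorm M (rep M b.src - rep M (Site.blockSite (blockOf b.src) (fun _ => ⟨0, Params.L_pos _⟩))) ≤ (L : ℝ) - 1 :=
      torusSupNorm_anchor_le hj b.src
    have h2 : torusSupNorm M (rep M (Site.blockSite (blockOf b.src) (fun _ => ⟨0, Params.L_pos _⟩)) -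
        rep M (Site.blockSite e.1.src (fun _ => ⟨0, Params.L_pos _⟩))) ≤ L := by
      rcases hblk with h | h
      · rw [h, sub_self, torusSupNorm_zero]; exact Nat.cast_nonneg L
      · rw [h]
        exact anchor_shift_le hj e.1.src e.1.dir
    linarith [torusSupNorm_sub_le M (rep M b.src) (rep M (Site.blockSite (blockOf b.src) (fun _ => ⟨0, Params.L_pos _⟩)))
      (rep M (Site.blockSite e.1.src (fun _ => ⟨0, Params.L_pos _⟩)))]

include hw in
/-- **TRANSFER**: a decay bound `|⟨e_b, C̃^{(j)}_Λe_{b′}⟩| ≤ A·e^{−δ|x_b − x_{b′}|_T}` (`A, δ ≥ 0`) gives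
`|⟨e_i, QGQ*e_{i′}⟩| ≤ A·e^{2δ(2L−1)}·e^{−δ|p(i) − p(i′)|_T}` (locality of `Q″` and its unit column masses `Σ_b q_i(b) = 1`).
[cite: Balaban1984PropagatorsII, p.248 (text after (2.147))] -/
theorem kernel2147_decay_of_Ct_decay (hj : j + 1 ≤ m + K) {A δ : ℝ} (hA : 0 ≤ A) (hδ : 0 ≤ δ)
    (hC : ∀ b b' : PBond (⟨d + 1, L, m, K, hd, hL⟩ : Params) j,
      |⟪EuclideanSpace.single b (1 : ℝ), (tsV1 hc Λ' w).Ct (EuclideanSpace.single b' (1 : ℝ))⟫_ℝ| ≤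
        A * Real.exp (-(δ * torusSupNorm (Mk ⟨d + 1, L, m, K, hd, hL⟩ j)
          (rep (Mk ⟨d + 1, L, m, K, hd, hL⟩ j) b.src - rep (Mk ⟨d + 1, L, m, K, hd, hL⟩ j) b'.src))))
    (i i' : CIdx j Λ') :
    |⟪EuclideanSpace.single i (1 : ℝ),
        (tsV1 hc Λ' w).Q ((tsV1 hc Λ' w).G (LinearMap.adjoint (tsV1 hc Λ' w).Q (EuclideanSpace.single i' (1 : ℝ))))⟫_ℝ| ≤
      A * Real.exp (2 * δ * (2 * (L : ℝ) - 1)) *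
        Real.exp (-(δ * torusSupNorm (Mk ⟨d + 1, L, m, K, hd, hL⟩ j)
          (Sum.elim (fun o : OutBond j Λ' => rep (Mk ⟨d + 1, L, m, K, hd, hL⟩ j) o.1.src)
              (fun e : InBond j Λ' => rep (Mk ⟨d + 1, L, m, K, hd, hL⟩ j) (Site.blockSite e.1.src (fun _ => ⟨0, Params.L_pos _⟩))) i -
            Sum.elim (fun o : OutBond j Λ' => rep (Mk ⟨d + 1, L, m, K, hd, hL⟩ j) o.1.src)
              (fun e : InBond j Λ' => rep (Mk ⟨d + 1, L, m, K, hd, hL⟩ j) (Site.blockSite e.1.src (fun _ => ⟨0, Params.L_pos _⟩))) i'))) := by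
  set M := Mk (⟨d + 1, L, m, K, hd, hL⟩ : Params) j with hM
  set p : CIdx j Λ' → Fin (d + 1) → ℤ := Sum.elim (fun o : OutBond j Λ' => rep M o.1.src)
    (fun e : InBond j Λ' => rep M (Site.blockSite e.1.src (fun _ => ⟨0, Params.L_pos _⟩))) with hp
  set E := A * Real.exp (2 * δ * (2 * (L : ℝ) - 1)) * Real.exp (-(δ * torusSupNorm M (p i - p i'))) with hE
  have hE0 : 0 ≤ E := by positivity
  -- termwise
  have hpt : ∀ b b' : PBond (⟨d + 1, L, m, K, hd, hL⟩ : Params) j,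
      |Qpp ⟨d + 1, L, m, K, hd, hL⟩ j Λ' (EuclideanSpace.single b (1 : ℝ)) i *
          ⟪EuclideanSpace.single b (1 : ℝ), (tsV1 hc Λ' w).Ct (EuclideanSpace.single b' (1 : ℝ))⟫_ℝ *
            Qpp ⟨d + 1, L, m, K, hd, hL⟩ j Λ' (EuclideanSpace.single b' (1 : ℝ)) i'| ≤
        Qpp ⟨d + 1, L, m, K, hd, hL⟩ j Λ' (EuclideanSpace.single b (1 : ℝ)) i * E *
          Qpp ⟨d + 1, L, m, K, hd, hL⟩ j Λ' (EuclideanSpace.single b' (1 : ℝ)) i' := by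
    intro b b'
    have hq := qpp_single_nonneg Λ' b i
    have hq' := qpp_single_nonneg Λ' b' i'
    rw [abs_mul, abs_mul, abs_of_nonneg hq, abs_of_nonneg hq']
    by_cases hz : Qpp ⟨d + 1, L, m, K, hd, hL⟩ j Λ' (EuclideanSpace.single b (1 : ℝ)) i *
        Qpp ⟨d + 1, L, m, K, hd, hL⟩ j Λ' (EuclideanSpace.single b' (1 : ℝ)) i' = 0
    · rcases mul_eq_zero.1 hz with h | h
      · rw [h, zero_mul, zero_mul, zero_mul, zero_mul]
      · rw [h, mul_zero, mul_zero]
    · have hne := mul_ne_zero_iff.1 hz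
      have h1 := dist_pos_le_of_qpp_ne_zero Λ' hj i b hne.1
      have h2 := dist_pos_le_of_qpp_ne_zero Λ' hj i' b' hne.2
      have htri : torusSupNorm M (p i - p i') ≤ torusSupNorm M (rep M b.src - rep M b'.src) + 2 * (2 * (L : ℝ) - 1) := by
        have ha : torusSupNorm M (p i - rep M b.src) ≤ 2 * (L : ℝ) - 1 := by
          rw [← torusSupNorm_neg M, neg_sub]; exact h1
        have hb : torusSupNorm M (rep M b'.src - p i') ≤ 2 * (L : ℝ) - 1 := h2
        linarith [torusSupNorm_sub_le M (p i) (rep M b.src) (p i'), torusSupNorm_sub_le M (rep M b.src) (rep M b'.src) (p i')]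
      have hexp : A * Real.exp (-(δ * torusSupNorm M (rep M b.src - rep M b'.src))) ≤ E := by
        rw [hE, mul_assoc, ← Real.exp_add]
        exact mul_le_mul_of_nonneg_left (Real.exp_le_exp.2 (by nlinarith)) hA
      calc _ ≤ Qpp ⟨d + 1, L, m, K, hd, hL⟩ j Λ' (EuclideanSpace.single b (1 : ℝ)) i *
            (A * Real.exp (-(δ * torusSupNorm M (rep M b.src - rep M b'.src)))) *
              Qpp ⟨d + 1, L, m, K, hd, hL⟩ j Λ' (EuclideanSpace.single b' (1 : ℝ)) i' :=
            mul_le_mul_of_nonneg_right (mul_le_mul_of_nonneg_left (hC b b') hq) hq'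
        _ ≤ _ := mul_le_mul_of_nonneg_right (mul_le_mul_of_nonneg_left hexp hq) hq'
  rw [inner_single_QGQ_single hc hj Λ' hw]
  calc |∑ b, ∑ b', Qpp ⟨d + 1, L, m, K, hd, hL⟩ j Λ' (EuclideanSpace.single b (1 : ℝ)) i *
          ⟪EuclideanSpace.single b (1 : ℝ), (tsV1 hc Λ' w).Ct (EuclideanSpace.single b' (1 : ℝ))⟫_ℝ *
            Qpp ⟨d + 1, L, m, K, hd, hL⟩ j Λ' (EuclideanSpace.single b' (1 : ℝ)) i'|
      ≤ ∑ b, ∑ b', Qpp ⟨d + 1, L, m, K, hd, hL⟩ j Λ' (EuclideanSpace.single b (1 : ℝ)) i * E *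
          Qpp ⟨d + 1, L, m, K, hd, hL⟩ j Λ' (EuclideanSpace.single b' (1 : ℝ)) i' :=
        (Finset.abs_sum_le_sum_abs _ _).trans (Finset.sum_le_sum fun b _ =>
          (Finset.abs_sum_le_sum_abs _ _).trans (Finset.sum_le_sum fun b' _ => hpt b b'))
    _ = E * ((∑ b, Qpp ⟨d + 1, L, m, K, hd, hL⟩ j Λ' (EuclideanSpace.single b (1 : ℝ)) i) *
          ∑ b', Qpp ⟨d + 1, L, m, K, hd, hL⟩ j Λ' (EuclideanSpace.single b' (1 : ℝ)) i') := by
        rw [Finset.sum_mul_sum, Finset.mul_sum]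
        refine Finset.sum_congr rfl fun b _ => ?_
        rw [Finset.mul_sum]
        exact Finset.sum_congr rfl fun b' _ => by ring
    _ = E := by rw [sum_qpp_single_col, sum_qpp_single_col, mul_one, mul_one]

end Decay

end Literature.MathematicalPhysics.QuantumFieldTheory.Balaban1983to89.B6Kernel2147DecayV1

end
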